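import Literature.NumberTheory.GaloisRepresentations.LubinTateNormOperator
import HarnessLib

/-!
# The torsion of the `𝒩`-invariant series: roots of unity only

De Shalit, *Iwasawa theory of elliptic curves with complex multiplication* (1987), Ch. I §2.1 ("If `a` is
in `𝒪'`, `𝒩a = a^q`") and the structure of `𝒰 = lim← U(k_π^n)` (I §3.7, III §1.1: "`𝒰` is a torsion-free
pro-`p` group"). By Coleman's interpolation theorem (`LubinTateColemanInterpolation.lean`) the norm-coherent
units of the Lubin–Tate tower are the `𝒩`-invariant series `ℳ_f = {g ∈ 𝒪_F⟦X⟧ : 𝒩g = g}`. This file computes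
the TORSION of `ℳ_f` (everything **proved**, `f = πX + X^q` over any non-archimedean local field `F`, any
residue characteristic — at `p = 2` this is the "`±1 / μ_{2^∞}`" question of the cell's brick list):

* `colemanNorm_C` — **`𝒩(a) = a^q`** for constants `a ∈ 𝒪_F`.
* `PowerSeries.eq_one_of_pow_eq_one` — over a domain `R`, a power series with constant term `1` and
  `h^N = 1` (`N ≠ 0`) is `1` (leading term in characteristic `0`; Frobenius injectivity `frobenius_inj`
  peels off the `p`-part of `N` in characteristic `p`); `PowerSeries.eq_C_of_pow_eq_one` — **a torsion power
  series over a domain is constant**.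
* ★ `eq_C_of_colemanNorm_eq_of_pow_eq_one` — a torsion element of `ℳ_f` is a constant `a` with `a^q = a`
  (a `(q-1)`-st root of unity or `0`); ★ `eq_one_of_colemanNorm_eq_of_pow_eq_one` — **the PRINCIPAL part of
  `ℳ_f` (constant term `≡ 1 (mod π)`) is torsion-free**: `𝒩g = g`, `g(0) ≡ 1 (mod π)`, `g^N = 1`, `N ≠ 0`
  ⟹ `g = 1`. So `𝒰 = lim← U(K_π^{n+1})` has no torsion (for `p = 2`: the constant `-1` is congruent to `1`
  but `𝒩(-1) = (-1)^q = 1 ≠ -1`, i.e. `(-1)_n` is not norm-coherent).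

## References

* E. de Shalit, *Iwasawa theory of elliptic curves with complex multiplication* (1987), Ch. I §2.1
  (`𝒩a = a^q`), III §1.1 (`𝒰` torsion-free). [cite: deShalit1987, Ch. I §2.1]
* R. Coleman, *Division values in local fields*, Invent. Math. 53 (1979).

## Mathlib reuse

`frobenius_inj`, `ringChar.spec`, `CharP.char_is_prime_or_zero`, `geom_sum_mul`, `IsUnit.of_pow_eq_one`,
`PowerSeries.subst_C`, `Finset.prod_const`; from the tree: `LubinTateNormOperator.lean` (`colemanNorm`,
`map_subst_colemanNorm`), `LubinTateColeman.lean` (`nProd`, `transl`, `subst_injective`,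
`algebraMap_series_apply`), `LubinTateColemanNorm.lean` (`algebraMap_LTCoeff_injective`).
-/

noncomputable section

open Polynomial

/-! ### Torsion power series over a domain are constant -/

namespace PowerSeries

variable {R : Type*} [CommRing R] [IsDomain R]

/-- **A power series over a domain with constant term `1` and `h^N = 1`, `N ≠ 0`, is `1`.** If `N ≠ 0` in
`R⟦X⟧`, write `h^N - 1 = (h - 1) · Σ_{i<N} h^i` with the second factor of constant term `N ≠ 0`; if `N = 0` in
`R⟦X⟧` the characteristic `p` is prime and divides `N`, and `h^N = (h^{N/p})^p = 1` gives `h^{N/p} = 1` by the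
injectivity of Frobenius on the reduced ring `R⟦X⟧`. [cite: deShalit1987, Ch. III §1.1] -/
theorem eq_one_of_pow_eq_one {h : R⟦X⟧} (h1 : constantCoeff h = 1) {N : ℕ} (hN : N ≠ 0)
    (hpow : h ^ N = 1) : h = 1 := by
  induction N using Nat.strong_induction_on generalizing h with
  | _ N ih =>
    by_cases hNR : (N : R⟦X⟧) = 0
    · -- characteristic `p ∣ N`, peel off one `p`
      have hdvd : ringChar R⟦X⟧ ∣ N := (ringChar.spec R⟦X⟧ N).mp hNR
      have hp0 : ringChar R⟦X⟧ ≠ 0 := by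
        intro h0; rw [h0, zero_dvd_iff] at hdvd; exact hN hdvd
      have hprime : (ringChar R⟦X⟧).Prime :=
        (CharP.char_is_prime_or_zero R⟦X⟧ (ringChar R⟦X⟧)).resolve_right hp0
      haveI : Fact (ringChar R⟦X⟧).Prime := ⟨hprime⟩
      obtain ⟨M, hM⟩ := hdvd
      have hM0 : M ≠ 0 := by rintro rfl; rw [mul_zero] at hM; exact hN hM
      have hMlt : M < N := by
        rw [hM]; exact lt_mul_left (Nat.pos_of_ne_zero hM0) hprime.one_lt
      have hfrob : frobenius R⟦X⟧ (ringChar R⟦X⟧) (h ^ M) = frobenius R⟦X⟧ (ringChar R⟦X⟧) 1 := by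
        rw [frobenius_def, frobenius_def, one_pow, ← pow_mul, mul_comm, ← hM, hpow]
      exact ih M hMlt h1 hM0 (frobenius_inj R⟦X⟧ (ringChar R⟦X⟧) hfrob)
    · -- `N ≠ 0` in `R⟦X⟧`: `(h - 1) · (Σ_{i<N} h^i) = h^N - 1 = 0` and the sum has constant term `N`
      have hgeom : (∑ i ∈ Finset.range N, h ^ i) * (h - 1) = 0 := by
        rw [geom_sum_mul, hpow, sub_self]
      have hsum : (∑ i ∈ Finset.range N, h ^ i) ≠ 0 := by
        intro h0
        have h2 := congrArg constantCoeff h0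
        rw [map_sum, map_zero] at h2
        simp only [map_pow, h1, one_pow, Finset.sum_const, Finset.card_range, nsmul_eq_mul, mul_one] at h2
        exact hNR (by rw [← map_natCast (C (R := R)), h2, map_zero])
      have h3 := (mul_eq_zero.mp hgeom).resolve_left hsum
      exact sub_eq_zero.mp h3

/-- **A torsion power series over a domain is constant**: `g^N = 1`, `N ≠ 0` ⟹ `g = C(g₀)` with `g₀^N = 1`.
[cite: deShalit1987, Ch. III §1.1] -/
theorem eq_C_of_pow_eq_one {g : R⟦X⟧} {N : ℕ} (hN : N ≠ 0) (hpow : g ^ N = 1) :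
    g = C (constantCoeff g) ∧ constantCoeff g ^ N = 1 := by
  have ha : constantCoeff g ^ N = 1 := by rw [← map_pow, hpow, map_one]
  refine ⟨?_, ha⟩
  obtain ⟨u, hu⟩ := IsUnit.of_pow_eq_one ha hN
  -- `h = g · u⁻¹` has constant term `1` and `h^N = 1`
  have h1 : constantCoeff (g * C ((u⁻¹ : Rˣ) : R)) = 1 := by
    rw [map_mul, constantCoeff_C, ← hu, Units.mul_inv]
  have huN : u ^ N = 1 := Units.ext (by rw [Units.val_pow_eq_pow_val, hu, ha, Units.val_one])
  have huinv : ((u⁻¹ : Rˣ) : R) ^ N = 1 := by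
    rw [← Units.val_pow_eq_pow_val, inv_pow, huN, inv_one, Units.val_one]
  have hpow' : (g * C ((u⁻¹ : Rˣ) : R)) ^ N = 1 := by
    rw [mul_pow, hpow, one_mul, ← map_pow, huinv, map_one]
  have key := eq_one_of_pow_eq_one h1 hN hpow'
  calc g = g * C ((u⁻¹ : Rˣ) : R) * C (u : R) := by
        rw [mul_assoc, ← map_mul, Units.inv_mul, map_one, mul_one]
    _ = C (constantCoeff g) := by rw [key, one_mul, hu]

end PowerSeries

namespace Literature.NumberTheory.GaloisRepresentations

section LocalFieldT

open GaloisRepresentations.IsNonarchimedeanLocalField LubinTate ValuativeRel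

variable (F : Type*) [Field F] [ValuativeRel F] [TopologicalSpace F] [IsNonarchimedeanLocalField F]

attribute [local instance] ltNormUniformSpace ltNormIsUniformAddGroup rk1 nF nE fintypeResidueField

variable {F}
variable {π : 𝒪[F]} (hπ : (valuation F).IsUniformizer (π : F)) (n : ℕ)

/-! ### `𝒩(a) = a^q` on constants -/

/-- The translate of a constant is the constant: `(C a)(X [+] ω) = C a`. [cite: deShalit1987, Ch. I §2.1] -/
theorem transl_C {E : IntermediateField F (AlgebraicClosure F)} [FiniteDimensional F E]
    {hA : IsLTRing (LTCoeff.of F π) (residueFieldCard F)} (ω : (maxNilIdeal F E).toIdeal) (a : LTCoeff F) :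
    transl (maxNilIdeal F E) hA (isLTSeries_LTCoeff π) ω (PowerSeries.C a) =
      PowerSeries.C (algebraMap (LTCoeff F) (unitBall E) a) := by
  rw [transl, PowerSeries.C_eq_algebraMap, AlgHom.commutes, algebraMap_series_apply]

/-- **`𝒩(a) = a^q` for a constant `a ∈ 𝒪_F`** ("If `a` is in `𝒪'`, `𝒩a = a^q`").
[cite: deShalit1987, Ch. I §2.1] -/
theorem colemanNorm_C (a : LTCoeff F) :
    colemanNorm hπ n (PowerSeries.C a) = PowerSeries.C (a ^ residueFieldCard F) := by
  refine subst_injective (isLTRing_LTCoeff hπ) (isLTSeries_ltSer π) ?_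
  change PowerSeries.subst (ltSer F π) (colemanNorm hπ n (PowerSeries.C a)) =
    PowerSeries.subst (ltSer F π) (PowerSeries.C (a ^ residueFieldCard F))
  refine PowerSeries.map_injective _ (algebraMap_LTCoeff_injective (ltField π n)) ?_
  rw [map_subst_colemanNorm, ← mul_one (PowerSeries.C (a ^ residueFieldCard F)),
    subst_C_mul (isLTSeries_ltSer π), subst_one (isLTSeries_ltSer π), mul_one, nProd]
  simp_rw [transl_C]
  rw [Finset.prod_const, Finset.card_univ, ← map_pow, ← map_pow, PowerSeries.map_C,
    show Fintype.card 𝓀[F] = residueFieldCard F by rw [residueFieldCard, Nat.card_eq_fintype_card]]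

/-! ### Torsion of `ℳ_f` -/

/-- ★ **A torsion `𝒩`-invariant series is a constant `a` with `a^q = a`** (`g^N = 1`, `N ≠ 0`, `𝒩g = g` ⟹
`g = C(g₀)`, `g₀^q = g₀`: the torsion of `ℳ_f` is `μ_{q-1}(F)`). [cite: deShalit1987, Ch. I §2.1] -/
theorem eq_C_of_colemanNorm_eq_of_pow_eq_one {g : PowerSeries (LTCoeff F)} (hg : colemanNorm hπ n g = g)
    {N : ℕ} (hN : N ≠ 0) (hpow : g ^ N = 1) :
    g = PowerSeries.C (PowerSeries.constantCoeff g) ∧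
      PowerSeries.constantCoeff g ^ residueFieldCard F = PowerSeries.constantCoeff g := by
  haveI : IsDomain (LTCoeff F) := inferInstanceAs (IsDomain 𝒪[F])
  obtain ⟨hC, -⟩ := PowerSeries.eq_C_of_pow_eq_one hN hpow
  refine ⟨hC, ?_⟩
  have h1 := hg
  rw [hC, colemanNorm_C] at h1
  have h2 := congrArg PowerSeries.constantCoeff h1
  rwa [PowerSeries.constantCoeff_C, PowerSeries.constantCoeff_C] at h2

include hπ in
/-- A unit `a ∈ 𝒪_F` with `a ≡ 1 (mod π)` and `a^q = a` is `1` (`(a - 1) · Σ_{i<q-1} a^i = a^{q-1} - 1 = 0`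
and the sum is `≡ q - 1 ≡ -1`, a unit). [cite: SerreLocalFields1979, Ch. II §4 Prop. 8] -/
theorem eq_one_of_pow_residueFieldCard_eq {a : 𝒪[F]} (hdvd : π ∣ a - 1) (ha : a ^ residueFieldCard F = a) :
    a = 1 := by
  have hq : 1 < residueFieldCard F := one_lt_residueFieldCard F
  have hπm : π ∈ 𝓂[F] := (mem_maximalIdeal_iff_valuation_lt_one _).mpr hπ.val_lt_one
  -- `a` is a unit
  have hau : IsUnit a := by
    by_contra hna
    have hmem : a ∈ 𝓂[F] := (IsLocalRing.mem_maximalIdeal _).mpr hna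
    have h1m : (1 : 𝒪[F]) ∈ 𝓂[F] := by
      have : (1 : 𝒪[F]) = a - (a - 1) := by ring
      rw [this]
      obtain ⟨c, hc⟩ := hdvd
      exact sub_mem hmem (hc ▸ Ideal.mul_mem_right _ _ hπm)
    exact (IsLocalRing.maximalIdeal.isMaximal 𝒪[F]).ne_top ((Ideal.eq_top_iff_one _).mpr h1m)
  -- `a^{q-1} = 1`
  have hpow : a ^ (residueFieldCard F - 1) = 1 := by
    have e : a * a ^ (residueFieldCard F - 1) = a * 1 := by
      rw [mul_one, ← pow_succ', Nat.sub_add_cancel hq.le, ha]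
    exact hau.mul_left_cancel e
  -- the geometric sum is a unit: its residue is `q - 1 = -1`
  have hgeom : (∑ i ∈ Finset.range (residueFieldCard F - 1), a ^ i) * (a - 1) = 0 := by
    rw [geom_sum_mul, hpow, sub_self]
  have hres : IsLocalRing.residue 𝒪[F] a = 1 := by
    have h0 : IsLocalRing.residue 𝒪[F] (a - 1) = 0 := by
      rw [IsLocalRing.residue_eq_zero_iff]
      obtain ⟨c, hc⟩ := hdvd
      rw [hc]; exact Ideal.mul_mem_right _ _ hπm
    rwa [map_sub, map_one, sub_eq_zero] at h0
  have hqz : ((residueFieldCard F : ℕ) : 𝓀[F]) = 0 := by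
    rw [residueFieldCard, Nat.card_eq_fintype_card]
    exact Nat.cast_card_eq_zero _
  have hne : ((residueFieldCard F - 1 : ℕ) : 𝓀[F]) ≠ 0 := by
    intro h0
    have h1 : ((residueFieldCard F - 1 : ℕ) : 𝓀[F]) + 1 = (residueFieldCard F : 𝓀[F]) := by
      rw [← Nat.cast_succ, Nat.succ_eq_add_one, Nat.sub_add_cancel hq.le]
    rw [h0, zero_add, hqz] at h1
    exact one_ne_zero h1
  have hress : IsLocalRing.residue 𝒪[F] (∑ i ∈ Finset.range (residueFieldCard F - 1), a ^ i) =
      ((residueFieldCard F - 1 : ℕ) : 𝓀[F]) := by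
    rw [map_sum]
    simp only [map_pow, hres, one_pow, Finset.sum_const, Finset.card_range, nsmul_eq_mul, mul_one]
  have hsumu : IsUnit (∑ i ∈ Finset.range (residueFieldCard F - 1), a ^ i) := by
    by_contra hns
    exact hne (hress ▸ (IsLocalRing.residue_eq_zero_iff _).mpr ((IsLocalRing.mem_maximalIdeal _).mpr hns))
  have h3 := (hsumu.mul_right_eq_zero).mp hgeom
  exact sub_eq_zero.mp h3

/-- ★ **The principal `𝒩`-invariant series are torsion-free**: `𝒩g = g`, `g(0) ≡ 1 (mod π)`, `g^N = 1`,
`N ≠ 0` ⟹ `g = 1`. Via Coleman's interpolation theorem this is the torsion-freeness of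
`𝒰 = lim← U(K_π^{n+1})` (de Shalit III §1.1 "`𝒰` is a torsion-free pro-`p` group"; at `p = 2` the constant
`-1 ≡ 1` is excluded because `𝒩(-1) = (-1)^q = 1 ≠ -1`). [cite: deShalit1987, Ch. III §1.1] -/
theorem eq_one_of_colemanNorm_eq_of_pow_eq_one {g : PowerSeries (LTCoeff F)} (hg : colemanNorm hπ n g = g)
    (hprinc : LTCoeff.of F π ∣ PowerSeries.constantCoeff g - 1) {N : ℕ} (hN : N ≠ 0) (hpow : g ^ N = 1) :
    g = 1 := by
  obtain ⟨hC, hq⟩ := eq_C_of_colemanNorm_eq_of_pow_eq_one hπ n hg hN hpow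
  have hdvd : π ∣ (LTCoeff.of F).symm (PowerSeries.constantCoeff g) - 1 := by
    obtain ⟨c, hc⟩ := hprinc
    refine ⟨(LTCoeff.of F).symm c, (LTCoeff.of F).injective ?_⟩
    rw [map_sub, map_one, map_mul, RingEquiv.apply_symm_apply, RingEquiv.apply_symm_apply]
    exact hc
  have hq' : ((LTCoeff.of F).symm (PowerSeries.constantCoeff g)) ^ residueFieldCard F =
      (LTCoeff.of F).symm (PowerSeries.constantCoeff g) := by
    rw [← map_pow, hq]
  have h1 := eq_one_of_pow_residueFieldCard_eq hπ hdvd hq'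
  have h2 : PowerSeries.constantCoeff g = 1 := by
    have := congrArg (LTCoeff.of F) h1
    rwa [RingEquiv.apply_symm_apply, map_one] at this
  rw [hC, h2, map_one]

end LocalFieldT

end Literature.NumberTheory.GaloisRepresentations
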